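import Summits.BirchSwinnertonDyer.Rank1Residual.GaloisImage.WildFiveNineTorsionValuation
import Summits.BirchSwinnertonDyer.Rank1Residual.GaloisImage.WildThreeAdicTower
import Summits.BirchSwinnertonDyer.Rank1Residual.GaloisImage.ThreeTorsionInertiaTame
import HarnessLib

/-!
# The `3`-adic tower on the WILD locus `v₃(j − 1728) ≥ 5`: `ρ̄_{E,3}` onto ⟹ `ρ̄_{E,3ⁿ}` onto
# (cell `b2b-bsdres`, team n1011, seat p02 gen 3, OWNERS row T-b10 'wild tower at 3' ARM A, file F3c)

HONEST FRAMING (cell `b2b-bsdres`, run/shared/lean/b2b/bsd-rank1-residual/, verbatim in every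
file): the goal of the cell is to DELETE the COMBINATION-SHAPED residual classes of the
Birch–Swinnerton-Dyer formula for ALL analytic-rank `≤ 1` elliptic curves over `ℚ` — "full BSD
formula for every rank `≤ 1` curve in class `C`" assembled STRICTLY from published theorems — so
that the rank-`≤ 1` remainder becomes exactly the CONSTRUCTION-SHAPED classes, which are TYPED
(missing-input `Prop`s), NOT attempted. This is not "finishing BSD". Team n1011 (N10 / N11, the
additive block X4 ∧ `p = 3`): research route on the CONSTRUCTION-SHAPED class X4; no claim beyond the
stated classes; the label X4 is UNCHANGED by this file; nothing is booked. Theorems only (no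
definition, no named fact).

## What this file proves

* §1 `valuation_a₂_pow_six_le_of_shape_of_j_ge_five` — normal shape, `v(j − 1728) = v(3)^m`,
  `m ≥ 5` ⟹ `v(a₂)⁶ ≤ v(3)⁵` and `v(Δ) = 1` (the single-slope regime of files F3a/F3b).
* §2 `exists_valuation_data_wild5` — for `E/ℚ` with `v₃(j − 1728) = m ≥ 5`: TWO elements, read on
  any `ℚ`-model: `z₃ ∈ ℚ(E[3])`, the completed-square ordinate of a `3`-torsion point, with
  `v(z₃)⁸·v(3)^{3 + 2v₃(den Δ)} = v(3)^{2v₃(num Δ)}` (denominator `8`), and `ζ ∈ ℚ(E[9])`, a difference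
  of two `9`-torsion abscissae lying over DIFFERENT `3`-torsion abscissae, with
  `v(ζ)³⁶·v(3)^{1 + 6v₃(den Δ)} = v(3)^{6v₃(num Δ)}` (denominator `36`) — F3a/F3b pulled back along
  `VariableChangePoints.pointEquiv` exactly as in `WildThreeAdicTower`.
* §3 **`towerSurj_three_of_surj_of_five_le_padicValRat_j_sub`** — `E/ℚ` elliptic (any model),
  `v₃(j − 1728) ≥ 5`, `ρ̄_{E,3}` onto ⟹ `ρ̄_{E,3ⁿ}` onto for every `n`; Kato's (12.5.2).  Mechanism:
  `8 ∣ #ρ̄_{E,3}(I_𝔓)` (from `z₃`) ⟹ `3 ∤ #ρ̄_{E,3}(I_𝔓)` (p02 gen-2 §5c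
  `not_three_dvd_card_inertia_map_galoisRepTorsion_three_of_four_dvd`: tame character + the
  `GL₂(𝔽₃)` normaliser lemma), `9 ∣ #ρ̄_{E,9}(I_𝔓)` (from `ζ`), and the gen-2 criterion
  `forall_hasSurjectiveModNGaloisRep_three_pow_of_surj_of_valuation_of_not_three_dvd`
  (`#ker(ρ̄₉(I) → ρ̄₃(I)) ≥ 9 > 3` scalars ⟹ first-order inertia witness ⟹ Serre IV-23).
* The two regimes together (`1 ≤ v₃(j − 1728) ≠ 3 ⟹ tower`; EXOTIC ⟹ `v₃(j − 1728) = 3`) are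
  assembled in `WildThreeAdicTowerJForm`.

Census (EVIDENCE, p02 `census_m.out.txt`): `m = 5` on 3 408 wild surj(3) X4@3 `r_an = 0` cells, 177 of
them mod-`9`-certificate rows.  X4 stays CONSTRUCTION-SHAPED; nothing booked.

References: [SerreAbelianLadic1968] IV-23 Lemma 3; [Serre1972] §1; N. Elkies, arXiv:math/0612734.
-/

noncomputable section

set_option maxRecDepth 10000 -- numerals `x ^ 36` on the value group, see `WildShapeValuation`

open scoped Classical

open Polynomial WeierstrassCurve

namespace Summit.BirchSwinnertonDyer.Rank1Residual.GaloisImage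

open Literature.NumberTheory.EllipticCurves Literature.NumberTheory.GaloisRepresentations
  Rat.HeightOneSpectrum

/-! ### §1 The shape exponent for `m ≥ 5` -/

section Shape

variable {W : WeierstrassCurve (AlgebraicClosure ℚ)}

/-- **`m ≥ 5` ⟹ `v(a₂)⁶ ≤ v(3)⁵`** and `v(a₂² − 4) = 1`, in normal shape with
`v(a₂)²·v(2a₂² − 9)² = v(3)^m·v(a₂² − 4)` (the three regimes of `WildShapeValuation` §1). [folklore] -/
theorem valuation_a₂_pow_six_le_of_shape {m : ℕ} (hm5 : 5 ≤ m)
    (hj : (placeOver 3).valuation W.a₂ ^ 2 *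
        (placeOver 3).valuation (2 * W.a₂ ^ 2 - 9) ^ 2 =
      (placeOver 3).valuation (3 : AlgebraicClosure ℚ) ^ m *
        (placeOver 3).valuation (W.a₂ ^ 2 - 4)) :
    (placeOver 3).valuation (W.a₂ ^ 2 - 4) = 1 ∧
      (placeOver 3).valuation W.a₂ ^ 6 ≤ (placeOver 3).valuation (3 : AlgebraicClosure ℚ) ^ 5 := by
  set v := (placeOver 3).valuation with hv
  set t := v (3 : AlgebraicClosure ℚ) with ht
  have ht1 : t < 1 := valuation_three_lt_one
  have ht0 : t ≠ 0 := valuation_three_ne_zero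
  have htm1 : t ^ m < 1 := pow_lt_one₀ zero_le ht1 (by omega)
  set α := v W.a₂ with hα
  have h4 : v (4 : AlgebraicClosure ℚ) = 1 := by
    simpa using valuation_intCast_eq_one_of_not_dvd (n := 4) (by decide)
  have h9 : v (9 : AlgebraicClosure ℚ) = t ^ 2 := by
    rw [show (9 : AlgebraicClosure ℚ) = 3 ^ 2 by norm_num, map_pow]
  have h2a : v (2 * W.a₂ ^ 2) = α ^ 2 := by
    rw [map_mul, show v (2 : AlgebraicClosure ℚ) = 1 by
      simpa using valuation_intCast_eq_one_of_not_dvd (n := 2) (by decide), one_mul, map_pow]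
  have ha2 : v (W.a₂ ^ 2) = α ^ 2 := map_pow _ _ _
  have hαlt : α < 1 := by
    by_contra hge
    rw [not_lt] at hge
    have hα2 : 1 ≤ α ^ 2 := one_le_pow₀ hge
    have h29 : v (2 * W.a₂ ^ 2 - 9) = α ^ 2 := by
      rw [valuation_sub_eq_of_lt (by rw [h9, h2a]; exact (pow_lt_one₀ zero_le ht1 two_ne_zero).trans_le hα2), h2a]
    rcases hge.lt_or_eq with hgt | heq
    · have hα2' : 1 < α ^ 2 := one_lt_pow₀ hgt two_ne_zero
      have h24 : v (W.a₂ ^ 2 - 4) = α ^ 2 := by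
        rw [valuation_sub_eq_of_lt (by rw [h4, ha2]; exact hα2'), ha2]
      rw [h29, h24, pow_two (α ^ 2), ← mul_assoc] at hj
      have h4m : α ^ 2 * α ^ 2 = t ^ m :=
        mul_right_cancel₀ (ne_of_gt (lt_trans zero_lt_one hα2')) hj
      have : (1 : _) < t ^ m := by
        rw [← h4m]
        calc (1 : _) < α ^ 2 := hα2'
          _ = α ^ 2 * 1 := (mul_one _).symm
          _ ≤ α ^ 2 * α ^ 2 := mul_le_mul' le_rfl hα2'.le
      exact absurd (this.trans htm1) (lt_irrefl _)
    · have h24 : v (W.a₂ ^ 2 - 4) ≤ 1 := by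
        refine Valuation.map_sub_le _ ?_ (by rw [h4])
        rw [ha2, ← heq, one_pow]
      rw [h29, ← heq, one_pow, one_pow, one_mul] at hj
      have : t ^ m * v (W.a₂ ^ 2 - 4) < 1 :=
        mul_lt_one_of_nonneg_of_lt_one_left zero_le htm1 h24
      rw [← hj] at this
      exact absurd this (lt_irrefl _)
  have h24 : v (W.a₂ ^ 2 - 4) = 1 := by
    rw [valuation_sub_eq_of_lt' (by rw [h4, ha2]; exact pow_lt_one₀ zero_le hαlt two_ne_zero), h4]
  refine ⟨h24, ?_⟩
  rw [h24, mul_one] at hj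
  rcases lt_or_ge t α with htα | hαt
  · have h29 : v (2 * W.a₂ ^ 2 - 9) = α ^ 2 := by
      rw [valuation_sub_eq_of_lt (by rw [h9, h2a]; exact pow_lt_pow_left₀ htα zero_le two_ne_zero),
        h2a]
    rw [h29] at hj
    calc α ^ 6 = α ^ 2 * (α ^ 2) ^ 2 := by rw [← pow_mul, ← pow_add]
      _ = t ^ m := hj
      _ ≤ t ^ 5 := pow_le_pow_of_le_one' ht1.le hm5
  · calc α ^ 6 ≤ t ^ 6 := pow_le_pow_left₀ zero_le hαt 6
      _ ≤ t ^ 5 := pow_le_pow_of_le_one' ht1.le (by norm_num)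

/-- §1 in `j`-form (ELLIPTIC normal shape, `m ≥ 5`): `v(Δ) = 1` and `v(a₂)⁶ ≤ v(3)⁵`. [folklore] -/
theorem valuation_a₂_pow_six_le_of_shape_of_j_ge_five [W.IsElliptic] (h1 : W.a₁ = 0) (h3 : W.a₃ = 0)
    (h4 : W.a₄ = 1) (h6 : W.a₆ = 0) {m : ℕ} (hm5 : 5 ≤ m)
    (hj : (placeOver 3).valuation (W.j - 1728) = (placeOver 3).valuation (3 : AlgebraicClosure ℚ) ^ m) :
    (placeOver 3).valuation W.Δ = 1 ∧
      (placeOver 3).valuation W.a₂ ^ 6 ≤ (placeOver 3).valuation (3 : AlgebraicClosure ℚ) ^ 5 := by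
  set v := (placeOver 3).valuation with hv
  have h16 : v (16 : AlgebraicClosure ℚ) = 1 := by
    simpa using valuation_intCast_eq_one_of_not_dvd (n := 16) (by decide)
  have h32 : v (-32 : AlgebraicClosure ℚ) = 1 := by
    simpa using valuation_intCast_eq_one_of_not_dvd (n := -32) (by decide)
  have hrel := j_sub_mul_Δ_eq (W := W)
  rw [c₆_of_shape h1 h3 h4 h6, Δ_of_shape h1 h3 h4 h6] at hrel
  have hval := congrArg v hrel
  rw [map_mul, map_mul, hj, h16, one_mul, map_pow, map_mul, map_mul, h32, one_mul, mul_pow] at hval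
  obtain ⟨h24, h6'⟩ := valuation_a₂_pow_six_le_of_shape (W := W) hm5 hval.symm
  refine ⟨?_, h6'⟩
  rw [Δ_of_shape h1 h3 h4 h6, map_mul, h16, one_mul, h24]

end Shape

/-! ### §2 The two valuation data on a `ℚ`-model -/

section Main

variable (W : WeierstrassCurve ℚ) [W.IsElliptic]

/-- **The valuation data for `m ≥ 5`.**  For `E/ℚ` with `v₃(j − 1728) = m ≥ 5` there are: a point
`P = (x₀, y₀)` of `E(ℚ̄)` with `3P = O` whose completed-square ordinate `z₃ = y₀ + (a₁x₀ + a₃)/2 ≠ 0`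
has `v(z₃)⁸·v(3)^{3 + 2v₃(den Δ)} = v(3)^{2v₃(num Δ)}`, and two points `Q₁ = (x₁, ·)`, `Q₂ = (x₂, ·)`
with `9Qᵢ = O` whose abscissa difference `ζ = x₁ − x₂ ≠ 0` has
`v(ζ)³⁶·v(3)^{1 + 6v₃(den Δ)} = v(3)^{6v₃(num Δ)}`. [folklore] -/
theorem exists_valuation_data_wild5 {m : ℕ} (hm5 : 5 ≤ m) (hj : padicValRat 3 (W.j - 1728) = m) :
    (∃ (P : W.geomPoints) (x y : AlgebraicClosure ℚ)
      (h : (W.map (algebraMap ℚ (AlgebraicClosure ℚ))).toAffine.Nonsingular x y),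
      P = .some x y h ∧ (3 : ℤ) • P = 0 ∧
      y + (algebraMap ℚ (AlgebraicClosure ℚ) W.a₁ * x + algebraMap ℚ (AlgebraicClosure ℚ) W.a₃) / 2
        ≠ 0 ∧
      (placeOver 3).valuation (y + (algebraMap ℚ (AlgebraicClosure ℚ) W.a₁ * x +
          algebraMap ℚ (AlgebraicClosure ℚ) W.a₃) / 2) ^ 8 *
        (placeOver 3).valuation (3 : AlgebraicClosure ℚ) ^ (3 + 2 * padicValNat 3 W.Δ.den) =
      (placeOver 3).valuation (3 : AlgebraicClosure ℚ) ^ (2 * padicValInt 3 W.Δ.num)) ∧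
    (∃ (Q₁ Q₂ : W.geomPoints) (x₁ y₁ x₂ y₂ : AlgebraicClosure ℚ)
      (h₁ : (W.map (algebraMap ℚ (AlgebraicClosure ℚ))).toAffine.Nonsingular x₁ y₁)
      (h₂ : (W.map (algebraMap ℚ (AlgebraicClosure ℚ))).toAffine.Nonsingular x₂ y₂),
      Q₁ = .some x₁ y₁ h₁ ∧ Q₂ = .some x₂ y₂ h₂ ∧ (9 : ℤ) • Q₁ = 0 ∧ (9 : ℤ) • Q₂ = 0 ∧
      x₁ - x₂ ≠ 0 ∧
      (placeOver 3).valuation (x₁ - x₂) ^ 36 *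
        (placeOver 3).valuation (3 : AlgebraicClosure ℚ) ^ (1 + 6 * padicValNat 3 W.Δ.den) =
      (placeOver 3).valuation (3 : AlgebraicClosure ℚ) ^ (6 * padicValInt 3 W.Δ.num)) := by
  set v := (placeOver 3).valuation with hv
  set t := v (3 : AlgebraicClosure ℚ) with ht
  have ht0 : t ≠ 0 := valuation_three_ne_zero
  have hW3 : (3 : AlgebraicClosure ℚ) ≠ 0 := by norm_num
  -- normal shape and the regime `v(a₂)⁶ ≤ t⁵`, `v(Δ'') = 1`
  obtain ⟨C, h1, h3, h4, h6, hs, htC⟩ := exists_variableChange_normalShape (W.map (algebraMap ℚ (AlgebraicClosure ℚ)))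
  set E'' := C • W.map (algebraMap ℚ (AlgebraicClosure ℚ)) with hE''
  have hq0 : W.j - 1728 ≠ 0 := by
    intro h0; rw [h0, padicValRat.zero] at hj; exact_mod_cast (show (m : ℤ) ≠ 0 by omega) hj.symm
  have hjK : v (E''.j - 1728) = t ^ m := by
    have : E''.j - 1728 = algebraMap ℚ (AlgebraicClosure ℚ) (W.j - 1728) := by
      rw [show E''.j = (W.map (algebraMap ℚ (AlgebraicClosure ℚ))).j from variableChange_j _ _, map_j, map_sub,
        map_ofNat]
    rw [this]
    exact valuation_ratCast_eq_pow_of_padicValRat hq0 hj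
  obtain ⟨hΔ1, hA⟩ := valuation_a₂_pow_six_le_of_shape_of_j_ge_five (W := E'') h1 h3 h4 h6 hm5 hjK
  -- two distinct `3`-torsion abscissae `ξ₁`, `ξ₂`
  have hΨ0 : E''.Ψ₃ ≠ 0 := by
    intro h0; have := E''.natDegree_Ψ₃ hW3; rw [h0, natDegree_zero] at this
    exact absurd this (by norm_num)
  have hcard : Multiset.card E''.Ψ₃.roots = 4 := by
    rw [← E''.natDegree_Ψ₃ hW3]; exact splits_iff_card_roots.mp (IsAlgClosed.splits _)
  obtain ⟨ξ₁, hξ₁⟩ : ∃ ξ₁, ξ₁ ∈ E''.Ψ₃.roots :=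
    Multiset.card_pos_iff_exists_mem.mp (by rw [hcard]; norm_num)
  obtain ⟨ξ₂, hξ₂⟩ : ∃ ξ₂, ξ₂ ∈ E''.Ψ₃.roots.erase ξ₁ :=
    Multiset.card_pos_iff_exists_mem.mp (by rw [Multiset.card_erase_of_mem hξ₁, hcard]; norm_num)
  have hξ₂' : ξ₂ ∈ E''.Ψ₃.roots := Multiset.mem_of_mem_erase hξ₂
  have hξ₁4 := valuation_pow_four_of_isRoot_Ψ₃_wild5 h1 h3 h4 h6 hA ((mem_roots hΨ0).mp hξ₁)
  -- points of order `3` over `ξ₁`, `ξ₂` and points of order `9` above them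
  have mkpt : ∀ {ξ : (AlgebraicClosure ℚ)}, ξ ∈ E''.Ψ₃.roots → ∃ (η : (AlgebraicClosure ℚ)) (hP : E''.toAffine.Nonsingular ξ η),
      (3 : ℤ) • (Affine.Point.some ξ η hP : E''.toAffine.Point) = 0 := by
    intro ξ hξ
    obtain ⟨η, hη⟩ := IsAlgClosed.exists_pow_nat_eq (ξ ^ 3 + E''.a₂ * ξ ^ 2 + ξ) (by norm_num : 0 < 2)
    have hPeq : E''.toAffine.Equation ξ η := by
      rw [Affine.equation_iff, h1, h3, h4, h6, hη]; ring
    refine ⟨η, (Affine.equation_iff_nonsingular ..).mp hPeq, ?_⟩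
    refine (zsmul_some_eq_zero_iff_eval_ΨSq E'' _ 3).mpr ?_
    rw [ΨSq_three, eval_pow, ((mem_roots hΨ0).mp hξ).eq_zero, zero_pow two_ne_zero]
  obtain ⟨η₁, hP₁ns, hP₁3⟩ := mkpt hξ₁
  obtain ⟨η₂, hP₂ns, hP₂3⟩ := mkpt hξ₂'
  set φ := VariableChange.pointEquiv (W.map (algebraMap ℚ (AlgebraicClosure ℚ))) C with hφ
  -- divide by `3` on `W ⊗ ℚ̄` and push forward
  have mkQ : ∀ {ξ η : (AlgebraicClosure ℚ)} (hP : E''.toAffine.Nonsingular ξ η),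
      (3 : ℤ) • (Affine.Point.some ξ η hP : E''.toAffine.Point) = 0 →
      ∃ (Q₀ : (W.map (algebraMap ℚ (AlgebraicClosure ℚ))).toAffine.Point) (x'' y'' : (AlgebraicClosure ℚ))
        (h'' : E''.toAffine.Nonsingular x'' y''), φ Q₀ = .some x'' y'' h'' ∧ (9 : ℤ) • Q₀ = 0 ∧
        ξ * (E''.Ψ₃.eval x'') ^ 2 = (E''.Φ 3).eval x'' := by
    intro ξ η hP hP3
    set P₀ : (W.map (algebraMap ℚ (AlgebraicClosure ℚ))).toAffine.Point := φ.symm (Affine.Point.some ξ η hP) with hP₀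
    have hP₀3 : (3 : ℤ) • P₀ = 0 := by rw [hP₀, ← map_zsmul, hP3, map_zero]
    obtain ⟨Q₀, hQ₀3⟩ : ∃ Q₀ : (W.map (algebraMap ℚ (AlgebraicClosure ℚ))).toAffine.Point, (3 : ℤ) • Q₀ = P₀ :=
      W.zsmul_geomPoints_surjective_holds (n := 3) (by norm_num) P₀
    have hQ₀9 : (9 : ℤ) • Q₀ = 0 := by
      rw [show (9 : ℤ) = 3 * 3 by norm_num, mul_smul, hQ₀3, hP₀3]
    have hQ''3 : (3 : ℤ) • φ Q₀ = Affine.Point.some ξ η hP := by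
      rw [← map_zsmul, hQ₀3, hP₀, AddEquiv.apply_symm_apply]
    have hQ''0 : φ Q₀ ≠ 0 := by
      intro h0; rw [h0, smul_zero] at hQ''3; exact Affine.Point.some_ne_zero _ hQ''3.symm
    rcases hQ'' : φ Q₀ with _ | ⟨x'', y'', h''⟩
    · exact absurd hQ'' hQ''0
    rw [hQ''] at hQ''3
    refine ⟨Q₀, x'', y'', h'', hQ'', hQ₀9, ?_⟩
    have := mul_eval_ΨSq_of_zsmul_eq E'' h'' 3 hP hQ''3
    rwa [ΨSq_three, eval_pow] at this
  obtain ⟨Q₁, x₁, y₁, h₁, hQ₁, hQ₁9, hrel₁⟩ := mkQ hP₁ns hP₁3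
  obtain ⟨Q₂, x₂, y₂, h₂, hQ₂, hQ₂9, hrel₂⟩ := mkQ hP₂ns hP₂3
  -- the local valuations (files F3a, F3b)
  have hη₁ := valuation_Y_pow_eight_wild5 (W := E'') h1 h3 h4 h6 hA hP₁ns.left hξ₁4
  have hG₂ : (E''.Φ 3 - Polynomial.C ξ₂ * E''.Ψ₃ ^ 2).IsRoot x₂ := by
    rw [IsRoot.def, eval_sub, eval_mul, eval_C, eval_pow, ← hrel₂, sub_self]
  have hζ := valuation_sub_pow_36_of_cross_wild5 (W := E'') h1 h3 h4 h6 hA hrel₁ hξ₁ hξ₂ hG₂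
  -- back on `W`: `P₀ = (u²ξ₁ + r, u³η₁ + u²sξ₁ + t)`, `Qᵢ = (u²xᵢ + r, …)`
  have hP₁eq : (φ.symm (Affine.Point.some ξ₁ η₁ hP₁ns) : (W.map (algebraMap ℚ (AlgebraicClosure ℚ))).toAffine.Point) =
      .some (C.ofX ξ₁) (C.ofY ξ₁ η₁)
        ((VariableChange.nonsingular_ofXY_iff (W.map (algebraMap ℚ (AlgebraicClosure ℚ))) C ξ₁ η₁).mpr hP₁ns) := by
    rw [hφ, VariableChange.pointEquiv_symm_apply, VariableChange.pointInv_some]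
  have hQ₁eq : Q₁ = .some (C.ofX x₁) (C.ofY x₁ y₁)
      ((VariableChange.nonsingular_ofXY_iff (W.map (algebraMap ℚ (AlgebraicClosure ℚ))) C x₁ y₁).mpr h₁) := by
    have e := (φ.symm_apply_apply Q₁).symm
    rwa [hQ₁, hφ, VariableChange.pointEquiv_symm_apply, VariableChange.pointInv_some] at e
  have hQ₂eq : Q₂ = .some (C.ofX x₂) (C.ofY x₂ y₂)
      ((VariableChange.nonsingular_ofXY_iff (W.map (algebraMap ℚ (AlgebraicClosure ℚ))) C x₂ y₂).mpr h₂) := by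
    have e := (φ.symm_apply_apply Q₂).symm
    rwa [hQ₂, hφ, VariableChange.pointEquiv_symm_apply, VariableChange.pointInv_some] at e
  -- `v(u)¹² = v(Δ_W)` and the rational valuation of `Δ_W`
  have hu0 : (C.u : (AlgebraicClosure ℚ)) ≠ 0 := C.u.ne_zero
  have hvu0 : v (C.u : (AlgebraicClosure ℚ)) ≠ 0 := (Valuation.ne_zero_iff _).mpr hu0
  have hΔW : W.Δ ≠ 0 := W.isUnit_Δ.ne_zero
  have huΔ : v (C.u : (AlgebraicClosure ℚ)) ^ 12 = v (algebraMap ℚ (AlgebraicClosure ℚ) W.Δ) := by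
    have e1 : E''.Δ = (C.u⁻¹ : (AlgebraicClosure ℚ)ˣ) ^ 12 * algebraMap ℚ (AlgebraicClosure ℚ) W.Δ := by
      rw [hE'', variableChange_Δ, map_Δ]
    have := congrArg v e1
    rw [hΔ1, map_mul, map_pow, Units.val_inv_eq_inv_val, map_inv₀, inv_pow, eq_comm, inv_mul_eq_one₀ (pow_ne_zero _ hvu0)] at this
    exact this
  have hrat : v (algebraMap ℚ (AlgebraicClosure ℚ) W.Δ) * t ^ padicValNat 3 W.Δ.den = t ^ padicValInt 3 W.Δ.num :=
    valuation_ratCast_mul_pow_eq_pow (q := W.Δ) hΔW -- buildfix 08-21: ascription pins THIS file's `Algebra ℚ ℚ̄` instance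
  rw [← huΔ] at hrat
  have hz : C.ofY ξ₁ η₁ + (algebraMap ℚ (AlgebraicClosure ℚ) W.a₁ * C.ofX ξ₁ + algebraMap ℚ (AlgebraicClosure ℚ) W.a₃) / 2 =
      (C.u : (AlgebraicClosure ℚ)) ^ 3 * η₁ := by
    rw [VariableChange.ofY_def, VariableChange.ofX_def, hs, htC, map_a₁, map_a₃]; ring
  refine ⟨⟨φ.symm (Affine.Point.some ξ₁ η₁ hP₁ns), C.ofX ξ₁, C.ofY ξ₁ η₁, _, hP₁eq, ?_, ?_, ?_⟩,
    ⟨Q₁, Q₂, C.ofX x₁, C.ofY x₁ y₁, C.ofX x₂, C.ofY x₂ y₂, _, _, hQ₁eq, hQ₂eq, hQ₁9, hQ₂9, ?_, ?_⟩⟩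
  · -- `3P₀ = 0`
    have : (3 : ℤ) • φ.symm (Affine.Point.some ξ₁ η₁ hP₁ns) = 0 := by
      rw [← map_zsmul, hP₁3, map_zero]
    exact this
  · -- `z₃ ≠ 0`
    rw [hz]
    have hvη0 : v η₁ ≠ 0 := by
      intro h0; rw [h0, zero_pow (by norm_num), zero_mul] at hη₁; exact zero_ne_one hη₁
    exact mul_ne_zero (pow_ne_zero _ hu0) ((Valuation.ne_zero_iff _).mp hvη0)
  · -- valuation of `z₃ = u³η₁`
    rw [hz, map_mul, map_pow]
    calc (v (C.u : (AlgebraicClosure ℚ)) ^ 3 * v η₁) ^ 8 * t ^ (3 + 2 * padicValNat 3 W.Δ.den)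
        = (v (C.u : (AlgebraicClosure ℚ)) ^ 12 * t ^ padicValNat 3 W.Δ.den) ^ 2 * (v η₁ ^ 8 * t ^ 3) := by
          rw [mul_pow, ← pow_mul, mul_pow, ← pow_mul, ← pow_mul, pow_add,
            show 3 * 8 = 12 * 2 from rfl,
            show 2 * padicValNat 3 W.Δ.den = padicValNat 3 W.Δ.den * 2 from Nat.mul_comm _ _]
          simp only [mul_assoc, mul_comm, mul_left_comm]
      _ = t ^ (2 * padicValInt 3 W.Δ.num) := by
          rw [hrat, hη₁, mul_one, ← pow_mul, Nat.mul_comm (padicValInt 3 W.Δ.num) 2]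
  · -- `ζ ≠ 0`
    have hζ0 : v (x₁ - x₂) ≠ 0 := by
      intro h0; rw [h0, zero_pow (by norm_num), zero_mul] at hζ; exact zero_ne_one hζ
    rw [VariableChange.ofX_def, VariableChange.ofX_def, show (C.u : (AlgebraicClosure ℚ)) ^ 2 * x₁ + C.r -
      ((C.u : (AlgebraicClosure ℚ)) ^ 2 * x₂ + C.r) = (C.u : (AlgebraicClosure ℚ)) ^ 2 * (x₁ - x₂) by ring]
    exact mul_ne_zero (pow_ne_zero _ hu0) ((Valuation.ne_zero_iff _).mp hζ0)
  · -- valuation of `ζ = u²(x₁ − x₂)`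
    rw [VariableChange.ofX_def, VariableChange.ofX_def, show (C.u : (AlgebraicClosure ℚ)) ^ 2 * x₁ + C.r -
      ((C.u : (AlgebraicClosure ℚ)) ^ 2 * x₂ + C.r) = (C.u : (AlgebraicClosure ℚ)) ^ 2 * (x₁ - x₂) by ring, map_mul, map_pow]
    calc (v (C.u : (AlgebraicClosure ℚ)) ^ 2 * v (x₁ - x₂)) ^ 36 * t ^ (1 + 6 * padicValNat 3 W.Δ.den)
        = (v (C.u : (AlgebraicClosure ℚ)) ^ 12 * t ^ padicValNat 3 W.Δ.den) ^ 6 * (v (x₁ - x₂) ^ 36 * t) := by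
          rw [mul_pow, ← pow_mul, mul_pow, ← pow_mul, ← pow_mul, pow_add, pow_one,
            show 2 * 36 = 12 * 6 from rfl,
            show 6 * padicValNat 3 W.Δ.den = padicValNat 3 W.Δ.den * 6 from Nat.mul_comm _ _]
          simp only [mul_assoc, mul_comm, mul_left_comm]
      _ = t ^ (6 * padicValInt 3 W.Δ.num) := by
          rw [hrat, hζ, mul_one, ← pow_mul, Nat.mul_comm (padicValInt 3 W.Δ.num) 6]

end Main

/-! ### §3 The tower for `m ≥ 5` -/

section Tower

variable (W : WeierstrassCurve ℚ) [W.IsElliptic]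

/-- `IsCoprime k (k·z + 1)`, and hence `IsCoprime (k ^ n) (k·z + 1)`. [folklore] -/
theorem isCoprime_pow_mul_add_one (k z : ℤ) (n : ℕ) : IsCoprime (k ^ n) (k * z + 1) :=
  IsCoprime.pow_left ⟨-z, 1, by ring⟩

/-- **THE `3`-ADIC TOWER ON THE WILD LOCUS `v₃(j − 1728) ≥ 5`.**  Let `E/ℚ` be an elliptic curve
(any model) with `v₃(j(E) − 1728) = m ≥ 5` (so `v₃(j) = 3`; additive, potentially supersingular
at `3`) and `ρ̄_{E,3}` onto.  Then `ρ̄_{E,3ⁿ}` is onto for every `n`.  Proof: by §2, `ℚ(E[3])` contains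
an element of valuation with denominator `8`, so `8 ∣ #ρ̄_{E,3}(I_𝔓)` and (p02 gen-2 §5c) `3 ∤
#ρ̄_{E,3}(I_𝔓)`; `ℚ(E[9])` contains one with denominator `36`, so `9 ∣ #ρ̄_{E,9}(I_𝔓)`; the gen-2
criterion (`#ker(ρ̄₉(I) → ρ̄₃(I)) ≥ 9 > 3`: an inertia element trivial on `E[3]`, non-scalar on
`E[9]`; Serre IV-23) gives the tower. [cite: SerreAbelianLadic1968, Ch. IV §3.4, Lemma 3 (IV-23)] -/
theorem towerSurj_three_of_surj_of_five_le_padicValRat_j_sub {m : ℕ} (hm5 : 5 ≤ m)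
    (hj : padicValRat 3 (W.j - 1728) = m) (hsurj : W.HasSurjectiveModNGaloisRep 3) (n : ℕ) :
    W.HasSurjectiveModNGaloisRep (3 ^ n : ℕ) := by
  haveI : Fact (Nat.Prime 3) := ⟨Nat.prime_three⟩
  haveI : NeZero (3 : ℕ) := ⟨by norm_num⟩
  haveI : NeZero (9 : ℕ) := ⟨by norm_num⟩
  obtain ⟨⟨P, x, y, h, hP, hP3, hz0, hzval⟩, ⟨Q₁, Q₂, x₁, y₁, x₂, y₂, h₁, h₂, hQ₁, hQ₂, hQ₁9, hQ₂9,
    hζ0, hζval⟩⟩ := exists_valuation_data_wild5 W hm5 hj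
  -- place data over `3`
  obtain ⟨v, hv⟩ : ∃ v : IsDedekindDomain.HeightOneSpectrum (NumberField.RingOfIntegers ℚ),
      (primesEquiv v : ℕ) = 3 :=
    ⟨primesEquiv.symm ⟨3, Nat.prime_three⟩, by rw [Equiv.apply_symm_apply]⟩
  obtain ⟨𝔓, hmem, h𝔓⟩ := exists_ideal_placeOver 3 hv
  -- `8 ∣ e₃`, hence `3 ∤ e₃`
  have hP' : P ∈ geomTorsion W ((3 : ℕ) : ℤ) := (mem_geomTorsion_iff W _ P).mpr (by exact_mod_cast hP3)
  obtain ⟨hxL, hyL⟩ := W.mem_divisionField_of_eq_some (n := 3) (T := ⟨P, hP'⟩) hP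
  have hz3L : y + (algebraMap ℚ (AlgebraicClosure ℚ) W.a₁ * x + algebraMap ℚ (AlgebraicClosure ℚ) W.a₃) / 2 ∈ W.divisionField 3 := by
    refine add_mem hyL (div_mem (add_mem (mul_mem ?_ hxL) ?_) ?_)
    · exact IntermediateField.algebraMap_mem _ _
    · exact IntermediateField.algebraMap_mem _ _
    · exact IntermediateField.natCast_mem _ 2
  have hcop3 : IsCoprime ((8 : ℕ) : ℤ)
      (((3 + 2 * padicValNat 3 W.Δ.den : ℕ) : ℤ) - ((2 * padicValInt 3 W.Δ.num : ℕ) : ℤ)) := by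
    have e : (((3 + 2 * padicValNat 3 W.Δ.den : ℕ) : ℤ) - ((2 * padicValInt 3 W.Δ.num : ℕ) : ℤ)) =
        2 * ((padicValNat 3 W.Δ.den : ℤ) - padicValInt 3 W.Δ.num + 1) + 1 := by push_cast; ring
    rw [e, show ((8 : ℕ) : ℤ) = 2 ^ 3 by norm_num]
    exact isCoprime_pow_mul_add_one 2 _ 3
  have h8 := dvd_card_inertia_map_galoisRepTorsion_of_valuation (W := W) (n := 3) hv hmem h𝔓 hz3L hz0
    hzval hcop3
  have h3 := not_three_dvd_card_inertia_map_galoisRepTorsion_three_of_four_dvd (W := W) hv h𝔓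
    ((show (4 : ℕ) ∣ 8 by norm_num).trans h8)
  -- `9 ∣ e₉` and the criterion
  have hQ₁' : Q₁ ∈ geomTorsion W ((9 : ℕ) : ℤ) :=
    (mem_geomTorsion_iff W _ Q₁).mpr (by exact_mod_cast hQ₁9)
  have hQ₂' : Q₂ ∈ geomTorsion W ((9 : ℕ) : ℤ) :=
    (mem_geomTorsion_iff W _ Q₂).mpr (by exact_mod_cast hQ₂9)
  obtain ⟨hx₁L, -⟩ := W.mem_divisionField_of_eq_some (n := 9) (T := ⟨Q₁, hQ₁'⟩) hQ₁
  obtain ⟨hx₂L, -⟩ := W.mem_divisionField_of_eq_some (n := 9) (T := ⟨Q₂, hQ₂'⟩) hQ₂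
  have hζL : x₁ - x₂ ∈ W.divisionField 9 := sub_mem hx₁L hx₂L
  have hcop9 : IsCoprime ((36 : ℕ) : ℤ)
      (((1 + 6 * padicValNat 3 W.Δ.den : ℕ) : ℤ) - ((6 * padicValInt 3 W.Δ.num : ℕ) : ℤ)) := by
    have e : (((1 + 6 * padicValNat 3 W.Δ.den : ℕ) : ℤ) - ((6 * padicValInt 3 W.Δ.num : ℕ) : ℤ)) =
        6 * ((padicValNat 3 W.Δ.den : ℤ) - padicValInt 3 W.Δ.num) + 1 := by push_cast; ring
    rw [e, show ((36 : ℕ) : ℤ) = 6 ^ 2 by norm_num]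
    exact isCoprime_pow_mul_add_one 6 _ 2
  exact forall_hasSurjectiveModNGaloisRep_three_pow_of_surj_of_valuation_of_not_three_dvd W hsurj hv
    hmem h𝔓 h3 hζL hζ0 hζval hcop9 (by norm_num) n

/-- **Kato's (12.5.2) at `3` on the wild locus `v₃(j − 1728) ≥ 5`.**
[cite: Kato2004Asterisque, (12.5.2) (p. 222)] -/
theorem imageContainsSL2_three_of_surj_of_five_le_padicValRat_j_sub {m : ℕ} (hm5 : 5 ≤ m)
    (hj : padicValRat 3 (W.j - 1728) = m) (hsurj : W.HasSurjectiveModNGaloisRep 3) :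
    Kato2004.ImageContainsSL2 W 3 := by
  haveI : Fact (Nat.Prime 3) := ⟨Nat.prime_three⟩
  exact (Kato2004.imageContainsSL2_iff_forall_hasSurjectiveModNGaloisRep W 3).mpr
    (towerSurj_three_of_surj_of_five_le_padicValRat_j_sub W hm5 hj hsurj)

end Tower

end Summit.BirchSwinnertonDyer.Rank1Residual.GaloisImage

end
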